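import Summits.AtomisticToContinuum.BoseEinsteinCondensation.Theses.BECRiccatiGhostPlasma

/-!
# Crux `EngineToAffinity` (stmt-AtomisticToContinuum-15142) — birth skeleton `Lines/birth.lean`

Route: `route-AtomisticToContinuum-BECRiccatiGhostPlasma` (sub-problem `BoseEinsteinCondensation`),
crux decl `Summit.AtomisticToContinuum.BoseEinsteinCondensation.Theses.BECRiccatiGhostPlasma.EngineToAffinity`
(rank 7, the ghost-plasma engine's TYPED JUNCTION, binder `hEJ` of the deciding theorem `closes`):
`PairKernelSplit → PinnedShadowClustering → BeyondPairGhostWork → (X on the BOUNDED class)`, i.e. for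
every bounded admissible `v`: `∃ ρ₀ ∀ ρ<ρ₀ ∃ C ∀ᶠ (N = n+1) ∀ δ>0 ∃` a nonnegative periodic
`δ`-near-minimiser `Ψ` with `∫⁻ |Ψ(x,Y)|² dY ≤ e^C ∫⁻ |Ψ(x,Y)||Ψ(y,Y)| dY` for all `x, y`.

## The line (the route header's own proof plan of the junction: KL step, then Palm–Jensen)

Positivity turns the one-particle density matrix of the exact ground state `Ψ₀ = e^(−S)` into a
Palm-law affinity, `γ(x,y)/γ(x,x) = E_(P_x)[e^(−(S_y − S_x))] ≥ exp(−½ KL(P_x ‖ P_y))` (Jensen), and the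
KL divergence of the two Palm laws is twice the Palm mean of the GHOST WORK `S_y − S_x`, which the
canonical (Hoeffding, uniform-measure) pair projection `u_H` of `S` splits into a PAIR part
`Σ_j (u_H(y,Y_j) − u_H(x,Y_j))` and a BEYOND-PAIR remainder.  The three engine cruxes deliver:
`PairKernelSplit` (F₂: `u_H = c + p + w`, `sup|p| ≤ ε`, `ρ∫|w| ≤ ε`), `PinnedShadowClustering` (S: the
exact positive translation-invariant ground state exists and its Palm laws at `x` and `y` differ only
through an integrable pinned envelope `θ`), `BeyondPairGhostWork` (P: the beyond-pair remainder has
bounded Palm mean).  The junction is cut along its two named steps plus the one place where F₂ and S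
meet:

* `stub_pairGhostWork` — **tagged-charge screening at pair level** (F₂ + S ⇒ the Palm mean of the PAIR
  ghost work of the S-witness is bounded, `≤ K₂ ∫Ψ(x,Y)² dY`, uniformly in `N` and in the separation;
  informal value `K₂ = 8K²` with `ε := 1`: the pair part is `(E_x − E_y)[Σ_j f(y − Y_j)]`, `f = p + w`,
  charged through S's one-body test family with `g = f⁺(y − ·)` at `(x,y)` and `g = f⁻(y − ·)` at
  `(y,x)`).  This is the load-bearing stub: it carries the crux's recorded risk (one-sided use of BOTH
  envelope bounds of S; torus bookkeeping of `θ(x − z)`, `w(y − z)` off the fundamental cell).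
* `stub_ghostWorkEntropy` — **ghost work ⇒ teleportation entropy** (pair bound ⊕ P ⇒ the body of the
  sibling crux `BECRieszShadow.TeleportEntropyBound`, stmt-9158, restated verbatim here as
  `TeleportEntropy`): `KL(P_x‖P_y) = ∫|Ψ_x|² log(|Ψ_x|²/|Ψ_y|²) = 2 E_x[S_y − S_x] ≤ 2(C_P + K₂)·mass`,
  x-independence of the slice mass `∫|Ψ(x,Y)|²dY` from translation invariance + periodicity (torus
  change of variables), exact ground state ⇒ `δ`-near-minimiser for every `δ > 0`, re-indexing
  `m + 2 ↦ n + 1`; genuine Lean content: continuity of the parametric integral `u_H`, integrability of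
  the two integrands on the bounded cell (Ψ is `C¹` and strictly positive), the torus shift.
* `stub_entropyAffinity` — **Palm–Jensen in `ℝ≥0∞` currency**, for EVERY strictly positive real
  periodic trial state with x-independent slice mass: `KL ≤ K·mass ⇒ ∫⁻|Ψ_x|² ≤ e^(K/2) ∫⁻|Ψ_x||Ψ_y|`
  (the support `PalmJensen`, stmt-9162, plus the Bochner → lintegral conversion; `C := K/2`).
* `EngineToAffinity_of : EngineToAffinity` (route decl BY NAME; the three stubs used BY NAME): the
  quantifier plumbing `ρ₀`, `C := C_T/2`, eventually in `n`, `δ`, the witness `Ψ`, its energy bound,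
  realness `Ψ = ↑‖Ψ‖` from `0 < re Ψ ∧ im Ψ = 0` (lemma `eq_coe_norm_of_re_pos`, sorry-free), and the
  affinity from `stub_entropyAffinity n L C_T Ψ`.  No `sorry` outside the three `stub_*`.

Sanity (`v ≡ 0`, `Ψ ≡ L^(−3N/2)`): `PairGhostWork` with `K₂ = 0` (`u_H` constant), `TeleportEntropy`
with `C = 0`, `stub_entropyAffinity` with `K = 0` is equality.  Degenerate parameters: `n = 0`
(`cellN 0 L = univ`, Dirac mass): slice hypothesis forces `|Ψ|` constant, KL hypothesis forces `K ≥ 0`,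
conclusion true; `L ≤ 0`, `n ≥ 1`: all integrals vanish.  No junk-value trap in `stub_entropyAffinity`:
under `0 < re Ψ`, `Ψ ∈ C¹`, the KL integrand is bounded and continuous on the bounded cell (the
`C < 0` lesson of `BECSwapAffinitySwapJensen_refuted` does not arise: `KL ≥ 0` at equal masses).

Disproof used: none exists for this crux (`ledger crux ls stmt-AtomisticToContinuum-15142`: no
workfiles, 2026-08-17); dead lines: none; negatives index (20 entries): no Palm/KL/affinity statement
other than `SwapJensen` (3980, `C` unrestricted in a truncated `ofReal` hypothesis) — not an instance
of any stub here (real-valued KL hypothesis, `exp (K/2)` conclusion, positivity everywhere).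
-/

namespace Summit.AtomisticToContinuum.BoseEinsteinCondensation.Cruxes.EngineToAffinity.Birth

open scoped BigOperators ENNReal NNReal
open MeasureTheory Filter
open Literature.MathematicalPhysics.QuantumManyBody.BoseGas
open Summit.AtomisticToContinuum.BoseEinsteinCondensation.Theses.BECRiccatiGhostPlasma

/-- **Bounded Palm-mean PAIR ghost work of the S-witness** (the meeting point of F₂ and S).  For every
bounded admissible `v`: `∃ ρ₀ ∀ ρ<ρ₀ ∃ K₂ ∀ᶠ m ∃` an EXACT strictly positive real translation-invariant
periodic ground state `Ψ` of `N = m+2` bosons on the torus of side `L = (N/ρ)^(1/3)` such that for all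
`x, y`: `∫_(cell^(m+1)) Ψ(x,Y)² Σ_j (u_H(y,Y_j) − u_H(x,Y_j)) dY ≤ K₂ ∫_(cell^(m+1)) Ψ(x,Y)² dY`, where
`u_H(a,z) = (ρ/(m+2))^m ∫_(cell^m) −log Ψ(a,z,W) dW` is the uniform-measure (Hoeffding) pair
projection of `S = −log Ψ` — spelled verbatim as inside `BeyondPairGhostWork`, so that the two bounds
add.  Informal value `K₂ = 8K²` (`K` of `PinnedShadowClustering`, `ε := 1` in `PairKernelSplit`);
`v ≡ 0`: `K₂ = 0`. [cite: Hoeffding1948; Reatto1969; McMillan1965] -/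
def PairGhostWork : Prop :=
  ∀ v : ℝ → ℝ≥0∞, IsRepulsiveFiniteRange v → (∃ M : NNReal, ∀ r, v r ≤ M) →
    ∃ ρ₀ : ℝ, 0 < ρ₀ ∧ ∀ ρ : ℝ, 0 < ρ → ρ < ρ₀ → ∃ K₂ : ℝ, ∀ᶠ m : ℕ in Filter.atTop,
      ∃ Ψ : PeriodicTrialState (m + 2) (sideLength ρ (m + 2)),
        periodicEnergy v Ψ = periodicGroundStateEnergy v (m + 2) (sideLength ρ (m + 2)) ∧
        (∀ X, 0 < (Ψ.ψ X).re ∧ (Ψ.ψ X).im = 0) ∧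
        (∀ (a : Space) (X : Config (m + 2)), Ψ.ψ (fun i => X i + a) = Ψ.ψ X) ∧
        ∀ x y : Space,
          ∫ Y in cellN (m + 1) (sideLength ρ (m + 2)),
              (Ψ.ψ (Matrix.vecCons x Y)).re ^ 2 *
                ∑ j : Fin (m + 1),
                  ((ρ / ((m : ℝ) + 2)) ^ m *
                      (∫ W in cellN m (sideLength ρ (m + 2)),
                        -Real.log ((Ψ.ψ (Matrix.vecCons y (Matrix.vecCons (Y j) W))).re)) -
                    (ρ / ((m : ℝ) + 2)) ^ m *
                      (∫ W in cellN m (sideLength ρ (m + 2)),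
                        -Real.log ((Ψ.ψ (Matrix.vecCons x (Matrix.vecCons (Y j) W))).re)))
            ≤ K₂ * ∫ Y in cellN (m + 1) (sideLength ρ (m + 2)), (Ψ.ψ (Matrix.vecCons x Y)).re ^ 2

/-- **Teleportation entropy of the true gas on the bounded class** — verbatim the body of the sibling
crux `Summit.AtomisticToContinuum.BoseEinsteinCondensation.Theses.BECRieszShadow.TeleportEntropyBound`
(stmt-AtomisticToContinuum-9158; restated here rather than imported so that this skeleton does not
depend on the sibling route file): for every bounded admissible `v`, `∃ ρ₀ ∀ ρ<ρ₀ ∃ C ∀ᶠ (N = n+1)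
∀ δ>0 ∃` a strictly positive real periodic `δ`-near-minimiser `Ψ` with x-independent slice mass and
`∫|Ψ(x,Y)|² log(|Ψ(x,Y)|²/|Ψ(y,Y)|²) dY ≤ C ∫|Ψ(x,Y)|² dY` for all `x, y` (`KL(P_x‖P_y) ≤ C`).
[cite: Reatto1969; McMillan1965; PenroseOnsager1956] -/
def TeleportEntropy : Prop :=
  ∀ v : ℝ → ℝ≥0∞, IsRepulsiveFiniteRange v → (∃ M : NNReal, ∀ r, v r ≤ M) →
    ∃ ρ₀ : ℝ, 0 < ρ₀ ∧ ∀ ρ : ℝ, 0 < ρ → ρ < ρ₀ → ∃ C : ℝ, ∀ᶠ n : ℕ in Filter.atTop,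
      ∀ δ : ℝ≥0∞, 0 < δ →
        ∃ Ψ : PeriodicTrialState (n + 1) (sideLength ρ (n + 1)),
          periodicEnergy v Ψ ≤ periodicGroundStateEnergy v (n + 1) (sideLength ρ (n + 1)) + δ ∧
          (∀ X, 0 < (Ψ.ψ X).re ∧ (Ψ.ψ X).im = 0) ∧
          (∀ x y : Space,
              ∫ Y in cellN n (sideLength ρ (n + 1)), ‖Ψ.ψ (Matrix.vecCons x Y)‖ ^ 2 =
                ∫ Y in cellN n (sideLength ρ (n + 1)), ‖Ψ.ψ (Matrix.vecCons y Y)‖ ^ 2) ∧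
          ∀ x y : Space,
            ∫ Y in cellN n (sideLength ρ (n + 1)),
                ‖Ψ.ψ (Matrix.vecCons x Y)‖ ^ 2 *
                  Real.log (‖Ψ.ψ (Matrix.vecCons x Y)‖ ^ 2 / ‖Ψ.ψ (Matrix.vecCons y Y)‖ ^ 2)
              ≤ C * ∫ Y in cellN n (sideLength ρ (n + 1)), ‖Ψ.ψ (Matrix.vecCons x Y)‖ ^ 2

/-- **stub 1 — `stub_pairGhostWork` (F₂ + S ⇒ bounded pair ghost work; the load-bearing stub).**
From `PairKernelSplit` (with `ε := 1`) and `PinnedShadowClustering`: take the S-witness `Ψ` (exact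
positive translation-invariant ground state, envelope `θ ≤ K`, `ρ∫_cell θ ≤ K`), write the pair ghost
work with `u_H(a,z) = c + p(a − z) + w(a − z)` as `(E_x − E_y)[Σ_j f(y − Y_j)]`, `f = p + w` (translation
invariance: `E_x[Σ_j f(x − Y_j)] = E_y[Σ_j f(y − Y_j)]`), and charge `f⁺(y − ·)` at `(x,y)`, `f⁻(y − ·)`
at `(y,x)` through S's one-body test family (`k = 1`): each `≤ Kρ ∫ g (θ(x − ·) + θ(y − ·)) ≤ 4K²`
(`sup|p| ≤ 1` against `ρ∫θ ≤ K`, `θ ≤ K` against `ρ∫|w| ≤ 1`), total `K₂ = 8K²`.  Why it might fail: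
exactly the crux's recorded risk — the envelope bounds of S are stated on the fundamental cell while
`θ(x − z)`, `w(y − z)` are evaluated on difference sets; the prover must reduce `x, y` to the cell by
periodicity and may need the periodicity/evenness of `f = p + w` (automatic: `u_H` is periodic and
symmetric) to move `p`, `w`, `θ` back onto the cell.  Size M–L.
[cite: Hoeffding1948; Reatto1969; McMillan1965; GirvinMacdonald1987] -/
theorem stub_pairGhostWork : PairKernelSplit → PinnedShadowClustering → PairGhostWork := by
  sorry

/-- **stub 2 — `stub_ghostWorkEntropy` (pair bound ⊕ beyond-pair bound ⇒ teleportation entropy).**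
For bounded admissible `v`: `ρ₀ :=` the minimum of the two thresholds, eventually in `m` (intersection
of the two `atTop` sets), `Ψ :=` the witness of `PairGhostWork` (an exact ground state, hence a
`δ`-near-minimiser for every `δ > 0`), `n := m + 1`; the slice mass `∫_(cell^n) |Ψ(x,Y)|² dY` is
x-independent by translation invariance + periodicity (measure-preserving shift of the torus
`(ℝ³/Lℤ³)^n`); `‖Ψ‖ = re Ψ > 0`, so `|Ψ_x|² log(|Ψ_x|²/|Ψ_y|²) = 2 (re Ψ_x)² (log re Ψ_x − log re Ψ_y)`
and the KL integral is `2 × (`beyond-pair integral of `BeyondPairGhostWork` `+` pair integral of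
`PairGhostWork)` `≤ 2(C_P + K₂) · mass` — additivity needs integrability of both integrands on the
bounded cell, i.e. continuity of the parametric integral `u_H` (`Ψ ∈ C¹`, strictly positive, so `−log Ψ`
is continuous and bounded on compact sets).  `C := 2(C_P + K₂)`.  Why plausibly true: pure real
analysis on a fixed `C¹` positive function; no physics.  Size M (Lean measure theory: torus shift,
parametric continuity, `m + 2 ↦ n + 1` re-indexing of the `atTop` filter).
[cite: Reatto1969; McMillan1965; Hoeffding1948] -/
theorem stub_ghostWorkEntropy : PairGhostWork → BeyondPairGhostWork → TeleportEntropy := by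
  sorry

/-- **stub 3 — `stub_entropyAffinity` (Palm–Jensen in `ℝ≥0∞` currency, every state).**  For every
`n, L, K` and every periodic trial state `Ψ` of `n+1` bosons with `0 < re Ψ`, `im Ψ = 0`, x-independent
slice mass `Z = ∫_(cell^n) |Ψ(x,Y)|² dY` and `∫|Ψ_x|² log(|Ψ_x|²/|Ψ_y|²) ≤ K·Z` for all `x, y`:
`∫⁻|Ψ_x|² ≤ e^(K/2) ∫⁻ |Ψ_x||Ψ_y|` for all `x, y`.  Proof route: the support `PalmJensen` (stmt-9162:
Jensen for `exp` under `p_x = |Ψ_x|²/Z`, `E_(p_x)[√(p_y/p_x)] ≥ exp(−½ KL(p_x‖p_y)) ≥ e^(−K/2)`) with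
`ψ := re ∘ Ψ.ψ ∘ vecCons`, then `ofReal` of the Bochner integrals `=` the lintegrals of `‖·‖₊` (continuous
integrands on a finite-measure set).  Degenerate cases hold (`n = 0`: Dirac slice, `K ≥ 0` forced;
`L ≤ 0 < n`: empty cell); no junk value under positivity + continuity.  Size S–M (provable now).
[cite: Reatto1969; McMillan1965; PenroseOnsager1956] -/
theorem stub_entropyAffinity :
    ∀ (n : ℕ) (L K : ℝ) (Ψ : PeriodicTrialState (n + 1) L),
      (∀ X, 0 < (Ψ.ψ X).re ∧ (Ψ.ψ X).im = 0) →
      (∀ x y : Space,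
          ∫ Y in cellN n L, ‖Ψ.ψ (Matrix.vecCons x Y)‖ ^ 2 =
            ∫ Y in cellN n L, ‖Ψ.ψ (Matrix.vecCons y Y)‖ ^ 2) →
      (∀ x y : Space,
          ∫ Y in cellN n L,
              ‖Ψ.ψ (Matrix.vecCons x Y)‖ ^ 2 *
                Real.log (‖Ψ.ψ (Matrix.vecCons x Y)‖ ^ 2 / ‖Ψ.ψ (Matrix.vecCons y Y)‖ ^ 2)
            ≤ K * ∫ Y in cellN n L, ‖Ψ.ψ (Matrix.vecCons x Y)‖ ^ 2) →
      ∀ x y : Space,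
        ∫⁻ Y in cellN n L, (‖Ψ.ψ (Matrix.vecCons x Y)‖₊ : ℝ≥0∞) ^ 2 ≤
          ENNReal.ofReal (Real.exp (K / 2)) *
            ∫⁻ Y in cellN n L,
              (‖Ψ.ψ (Matrix.vecCons x Y)‖₊ : ℝ≥0∞) * (‖Ψ.ψ (Matrix.vecCons y Y)‖₊ : ℝ≥0∞) := by
  sorry

/-- A complex number with positive real part and zero imaginary part is the cast of its norm
(realness conversion `0 < re Ψ ∧ im Ψ = 0 ⇒ Ψ = ↑‖Ψ‖` between the engine's and the frame's
positivity clauses). [folklore] -/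
theorem eq_coe_norm_of_re_pos {z : ℂ} (h : 0 < z.re ∧ z.im = 0) : z = ((‖z‖ : ℝ) : ℂ) := by
  obtain ⟨hre, him⟩ := h
  have hz : z = ((z.re : ℝ) : ℂ) := Complex.ext (by simp) (by simp [him])
  have hn : ‖z‖ = z.re := by
    rw [hz, Complex.norm_real, Real.norm_of_nonneg hre.le, Complex.ofReal_re]
  rw [hn]
  exact hz

/-! ### Composition certificate (hypothesis form, sorry-free)

`example : <stub 1 signature> → <stub 2 signature> → <stub 3 signature> → EngineToAffinity` — the pure
implication, kernel-checked at every elaboration with NO `sorry` (the same term, named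
`EngineToAffinity_of_hyp` in the seat's scratch file `bc/EngineToAffinity_birth_hypform.lean`, prints
axioms `propext, Classical.choice, Quot.sound`).  It is an `example` (not a constant) so that the
skeleton audit sees exactly one theorem concluding the crux: `EngineToAffinity_of` below. -/
example :
    (PairKernelSplit → PinnedShadowClustering → PairGhostWork) →
    (PairGhostWork → BeyondPairGhostWork → TeleportEntropy) →
    (∀ (n : ℕ) (L K : ℝ) (Ψ : PeriodicTrialState (n + 1) L),
      (∀ X, 0 < (Ψ.ψ X).re ∧ (Ψ.ψ X).im = 0) →
      (∀ x y : Space,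
          ∫ Y in cellN n L, ‖Ψ.ψ (Matrix.vecCons x Y)‖ ^ 2 =
            ∫ Y in cellN n L, ‖Ψ.ψ (Matrix.vecCons y Y)‖ ^ 2) →
      (∀ x y : Space,
          ∫ Y in cellN n L,
              ‖Ψ.ψ (Matrix.vecCons x Y)‖ ^ 2 *
                Real.log (‖Ψ.ψ (Matrix.vecCons x Y)‖ ^ 2 / ‖Ψ.ψ (Matrix.vecCons y Y)‖ ^ 2)
            ≤ K * ∫ Y in cellN n L, ‖Ψ.ψ (Matrix.vecCons x Y)‖ ^ 2) →
      ∀ x y : Space,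
        ∫⁻ Y in cellN n L, (‖Ψ.ψ (Matrix.vecCons x Y)‖₊ : ℝ≥0∞) ^ 2 ≤
          ENNReal.ofReal (Real.exp (K / 2)) *
            ∫⁻ Y in cellN n L,
              (‖Ψ.ψ (Matrix.vecCons x Y)‖₊ : ℝ≥0∞) * (‖Ψ.ψ (Matrix.vecCons y Y)‖₊ : ℝ≥0∞)) →
    EngineToAffinity := by
  intro h₁ h₂ h₃ hF hS hP v hv hM
  obtain ⟨ρ₀, hρ₀, H⟩ := h₂ (h₁ hF hS) hP v hv hM
  refine ⟨ρ₀, hρ₀, fun ρ hρ hρlt => ?_⟩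
  obtain ⟨C, hev⟩ := H ρ hρ hρlt
  refine ⟨C / 2, ?_⟩
  filter_upwards [hev] with n hn δ hδ
  obtain ⟨Ψ, hE, hpos, hslice, hkl⟩ := hn δ hδ
  exact ⟨Ψ, hE, fun X => eq_coe_norm_of_re_pos (hpos X), h₃ n _ C Ψ hpos hslice hkl⟩

/-- **Assembly / skeleton theorem.** `EngineToAffinity` (the route decl, BY NAME) from the three
declared stubs used BY NAME: `ρ₀` and `C_T` (eventually in `n`) from
`stub_ghostWorkEntropy (stub_pairGhostWork hF hS) hP` at the bounded admissible `v`; `C := C_T / 2`;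
for `δ > 0` the entropy witness `Ψ` is the affinity witness: its energy bound is passed through,
realness `Ψ = ↑‖Ψ‖` by `eq_coe_norm_of_re_pos`, and the affinity bound is
`stub_entropyAffinity n L C_T Ψ`.  No `sorry` of its own. -/
theorem EngineToAffinity_of : EngineToAffinity := by
  intro hF hS hP v hv hM
  obtain ⟨ρ₀, hρ₀, H⟩ := stub_ghostWorkEntropy (stub_pairGhostWork hF hS) hP v hv hM
  refine ⟨ρ₀, hρ₀, fun ρ hρ hρlt => ?_⟩
  obtain ⟨C, hev⟩ := H ρ hρ hρlt
  refine ⟨C / 2, ?_⟩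
  filter_upwards [hev] with n hn δ hδ
  obtain ⟨Ψ, hE, hpos, hslice, hkl⟩ := hn δ hδ
  exact ⟨Ψ, hE, fun X => eq_coe_norm_of_re_pos (hpos X),
    stub_entropyAffinity n _ C Ψ hpos hslice hkl⟩

end Summit.AtomisticToContinuum.BoseEinsteinCondensation.Cruxes.EngineToAffinity.Birth
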